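import Literature.MathematicalPhysics.QuantumManyBody.PeriodicBoseGas
import HarnessLib

/-!
# The periodic Bose gas with a pinned scatterer (static impurity)

Topic `Literature/MathematicalPhysics/QuantumManyBody` (definition item `defn-impurityPeriodicEnergy`,
wanted by route `BECImpurityMassFlow` of `AtomisticToContinuum/BoseEinsteinCondensation`, items
stmt-AtomisticToContinuum-3906/3907/3909, and the impurity/polaron idea cards
one-particle-at-a-time, kv-insertion-corrector, frozen-bath-anderson-endpoint). Companion of
`PeriodicBoseGas.lean` (namespace `Literature.MathematicalPhysics.QuantumManyBody.BoseGas`), whose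
carriers it reuses verbatim: the torus cell `cellN N L = [0,L)^{3N}`, the periodised pair potential
`periodizedPotential v L = v^per` [Fournais2020, (1.1)], periodic trial states
`PeriodicTrialState N L` and their energy `periodicEnergy v Φ = ⟨Φ, H(N,L) Φ⟩`.

## Content

* `impurityInteraction v L x X = ∑ⱼ v^per(xⱼ - x)` — the one-body potential created on the `N`
  bosons by ONE extra, infinitely heavy particle (a *pinned scatterer*, or static impurity) sitting
  at `x ∈ ℝ³` and coupled to each boson by the SAME pair potential `v`, periodised on the torus
  `ℝ³/Lℤ³` exactly as the boson–boson interaction.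
* `impurityPeriodicEnergy v x Φ = periodicEnergy v Φ + ∫_{[0,L)^{3N}} (∑ⱼ v^per(xⱼ - x)) |Φ|² dX`
  — the quadratic form of `H(N,L) + ∑ⱼ v^per(xⱼ - x)`, i.e. of Fournais's periodic Hamiltonian
  [Fournais2020, (1.1)] for `N + 1` particles in which particle `N + 1` is given infinite mass
  (its kinetic term dropped) and frozen at `x`. This is the `m_I = ∞` (static) case of the
  Bose-polaron Hamiltonian `H_bath + (impurity kinetic term) + ∑ⱼ U(xⱼ - x_imp)`
  [GuentherEtAl2021, eq. (4)]; at the Gross–Pitaevskii level it is the functional of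
  [AstrakharchikPitaevskii2004, eq. (1)] with `V = 0`. Here `U = v` (the route's modelling choice:
  the impurity is a tagged boson) and everything lives on the torus.
* `impurityPeriodicGroundStateEnergy v N L x = inf_Φ impurityPeriodicEnergy v x Φ` — its ground-state
  energy (bottom of the spectrum of the pinned-scatterer Hamiltonian on `⊗ˢᴺ L²(Ω)`, as an infimum
  of the form over the periodic `C¹` core, like `periodicGroundStateEnergy` [Fournais2020, (1.2)]).

The definitional lemmas `impurityPeriodicEnergy_def` / `impurityPeriodicGroundStateEnergy_def`
unfold to the INLINE expressions used verbatim in the route's filed statements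
(`periodicEnergy v Φ + ∫⁻ X in cellN N L, (∑ j, periodizedPotential v L (X j - x)) * ‖Φ.ψ X‖₊ ^ 2`
and its `⨅` over `PeriodicTrialState N L`), so provers can `rw` either way.

## API (all proved)

* monotonicity: `periodicEnergy_le_impurityPeriodicEnergy`, `impurityPeriodicGroundStateEnergy_le`
  (variational principle), `periodicGroundStateEnergy_le_impurityPeriodicGroundStateEnergy`;
* free case `v = 0`: `periodizedPotential_zero`, `impurityPeriodicEnergy_zero_potential`,
  `impurityPeriodicGroundStateEnergy_zero_potential`;
* lattice covariance in the scatterer position (`x ↦ x ± Ln`, the torus identification) at FIXED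
  state: `periodizedPotential_add_latticeVec`, `impurityInteraction_add_latticeVec`,
  `impurityPeriodicEnergy_add_latticeVec`, `impurityPeriodicGroundStateEnergy_add_latticeVec`
  (and `sub` forms); periodicity of the impurity potential in every boson coordinate
  (`impurityInteraction_add_single`) and its invariance under a common translation of scatterer
  and bosons (`impurityInteraction_add_const`, `periodicInteraction_add_const`) — the full
  translation invariance `E(x + t) = E(x)` of the ground-state energy, which needs the
  fundamental-domain shift of the cell, is in `PeriodicBoseGasImpurityTranslation.lean`;
* a priori bound and finiteness: `impurityInteraction_le`
  (`∑ⱼ v^per(xⱼ - x) ≤ N · sup v^per`), `impurityPeriodicEnergy_le_add`,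
  `impurityPeriodicGroundStateEnergy_le_add`
  (`E_imp(N,L,x) ≤ E(N,L) + N · sup v^per`), `impurityPeriodicGroundStateEnergy_ne_top`
  (finite whenever `E(N,L) < ∞` and `v^per` is bounded, e.g. bounded `v` of range `R₀ < L/2`).
  Finiteness for hard cores at low density (item stmt-AtomisticToContinuum-3909) is a genuine
  trial-state construction and is NOT done here.

## Design choices

* `ℝ≥0∞`-valued, like every energy in `PeriodicBoseGas.lean`; `v^per(xⱼ - x) = ⊤` (hard core of the
  scatterer) forces admissible finite-energy states to vanish there (`⊤ · 0 = 0`).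
* The scatterer position `x` ranges over all of `ℝ³` (not only the cell): by
  `impurityPeriodicEnergy_add_latticeVec` the energy only depends on `x mod Lℤ³`.
* No smallness, range or regularity assumption on `v` is built in: the definitions make sense for
  every `v : ℝ → ℝ≥0∞`, as `periodicEnergy` does.
* Mathlib has no many-body Schrödinger operators, impurities or polarons (searched `impurity`,
  `polaron`, `Bose`); nothing here duplicates `PeriodicBoseGas*.lean` (searched
  `periodizedPotential_`, `impurity`, `translate`).

## References

* [Fournais2020] S. Fournais, *Length scales for BEC in the dilute Bose gas*, arXiv:2011.00309,
  EMS Ser. Congr. Rep. 18 (2021): (1.1) `H = ∑ⱼ -Δⱼ^per + ∑_{j<k} v^per(xⱼ - x_k)`,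
  `v^per = ∑_{j∈ℤ³} v(x - Lj)`, (1.2) `E(N,L) = inf Spec H(N,L)`.
* [GuentherEtAl2021] N.-E. Guenther, R. Schmidt, G. M. Bruun, V. Gurarie, P. Massignan, *Mobile
  impurity in a Bose–Einstein condensate and the orthogonality catastrophe*, Phys. Rev. A 103,
  013317 (2021), arXiv:2004.07166: eq. (4) (impurity Hamiltonian; "For infinite impurity mass …
  reduces to the standard GPE for a static potential U(r)", p. 2).
* [AstrakharchikPitaevskii2004] G. E. Astrakharchik, L. P. Pitaevskii, *Motion of a heavy impurity
  through a Bose–Einstein condensate*, Phys. Rev. A 70, 013608 (2004), arXiv:cond-mat/0307247: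
  §2.1 eq. (1) (GP functional with a `δ`-impurity moving at velocity `V`).
-/

noncomputable section

open MeasureTheory
open scoped ENNReal NNReal

namespace Literature.MathematicalPhysics.QuantumManyBody.BoseGas

variable {N : ℕ} {L : ℝ}

/-! ### Definitions -/

/-- The **impurity potential** `V_x(X) = ∑ⱼ v^per(xⱼ - x) ∈ [0, ∞]` felt by the configuration
`X = (x₁, …, x_N)` of the bosons when one infinitely heavy particle is pinned at `x ∈ ℝ³` and
coupled to each boson by the periodised pair potential `v^per` (static limit `m_I = ∞` of the
impurity–bath coupling `∫ b†_r b_r U(r - s) a†_s a_s` with `U = v`, on the torus `ℝ³/Lℤ³`).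
[cite: GuentherEtAl2021, eq. (4) (m_I = ∞; periodised as in Fournais2020 (1.1))] -/
def impurityInteraction (v : ℝ → ℝ≥0∞) (L : ℝ) (x : Space) (X : Config N) : ℝ≥0∞ :=
  ∑ j : Fin N, periodizedPotential v L (X j - x)

/-- The **pinned-scatterer (static-impurity) energy** on the torus:
`⟨Φ, (H(N,L) + ∑ⱼ v^per(xⱼ - x)) Φ⟩ = periodicEnergy v Φ + ∫_{[0,L)^{3N}} (∑ⱼ v^per(xⱼ - x)) |Φ(X)|² dX`,
the quadratic form, on a periodic `N`-boson trial state `Φ`, of Fournais's periodic Hamiltonian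
`H(N,L) = ∑ⱼ -Δⱼ^per + ∑_{j<k} v^per(xⱼ - x_k)` [Fournais2020, (1.1)] plus the one-body potential of
an extra particle of infinite mass frozen at `x` and interacting through the SAME `v` (units
`ħ = 2m = 1`). Written with the inline sum so that `impurityPeriodicEnergy_def` is `rfl` against
the statements of route `BECImpurityMassFlow`.
[cite: GuentherEtAl2021, eq. (4) (m_I = ∞; quadratic form, periodic setting of Fournais2020 (1.1))] -/
def impurityPeriodicEnergy {N : ℕ} {L : ℝ} (v : ℝ → ℝ≥0∞) (x : Space) (Φ : PeriodicTrialState N L) :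
    ℝ≥0∞ :=
  periodicEnergy v Φ +
    ∫⁻ X in cellN N L, (∑ j : Fin N, periodizedPotential v L (X j - x)) * (‖Φ.ψ X‖₊ : ℝ≥0∞) ^ 2

/-- The **pinned-scatterer ground-state energy** `E_imp(N, L, x) = inf_Φ ⟨Φ, (H(N,L) + ∑ⱼ v^per(xⱼ - x)) Φ⟩`
(infimum of `impurityPeriodicEnergy` over the periodic `C¹` trial states; `⊤` if `L ≤ 0 < N`).
[cite: Fournais2020, (1.2) (with the static-impurity term of GuentherEtAl2021 eq. (4))] -/
def impurityPeriodicGroundStateEnergy (v : ℝ → ℝ≥0∞) (N : ℕ) (L : ℝ) (x : Space) : ℝ≥0∞ :=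
  ⨅ Φ : PeriodicTrialState N L, impurityPeriodicEnergy v x Φ

/-! ### Definitional unfolding -/

/-- `impurityPeriodicEnergy` unfolds to the inline expression of route `BECImpurityMassFlow`.
[folklore] -/
theorem impurityPeriodicEnergy_def (v : ℝ → ℝ≥0∞) (x : Space) (Φ : PeriodicTrialState N L) :
    impurityPeriodicEnergy v x Φ = periodicEnergy v Φ +
      ∫⁻ X in cellN N L, (∑ j : Fin N, periodizedPotential v L (X j - x)) *
        (‖Φ.ψ X‖₊ : ℝ≥0∞) ^ 2 :=
  rfl

/-- `impurityPeriodicEnergy` in terms of `impurityInteraction`. [folklore] -/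
theorem impurityPeriodicEnergy_eq (v : ℝ → ℝ≥0∞) (x : Space) (Φ : PeriodicTrialState N L) :
    impurityPeriodicEnergy v x Φ =
      periodicEnergy v Φ + ∫⁻ X in cellN N L, impurityInteraction v L x X * (‖Φ.ψ X‖₊ : ℝ≥0∞) ^ 2 :=
  rfl

/-- `impurityPeriodicGroundStateEnergy` unfolds to the inline infimum of route `BECImpurityMassFlow`.
[folklore] -/
theorem impurityPeriodicGroundStateEnergy_def (v : ℝ → ℝ≥0∞) (N : ℕ) (L : ℝ) (x : Space) :
    impurityPeriodicGroundStateEnergy v N L x = ⨅ Φ : PeriodicTrialState N L,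
      (periodicEnergy v Φ + ∫⁻ X in cellN N L, (∑ j : Fin N, periodizedPotential v L (X j - x)) *
        (‖Φ.ψ X‖₊ : ℝ≥0∞) ^ 2) :=
  rfl

/-! ### Monotonicity and the variational principle -/

/-- Adding the (non-negative) scatterer can only raise the energy of a given state:
`⟨Φ, HΦ⟩ ≤ ⟨Φ, (H + ∑ⱼ v^per(xⱼ - x))Φ⟩`. [folklore] -/
theorem periodicEnergy_le_impurityPeriodicEnergy (v : ℝ → ℝ≥0∞) (x : Space)
    (Φ : PeriodicTrialState N L) : periodicEnergy v Φ ≤ impurityPeriodicEnergy v x Φ :=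
  le_self_add

/-- Variational principle for the pinned-scatterer problem. [folklore] -/
theorem impurityPeriodicGroundStateEnergy_le (v : ℝ → ℝ≥0∞) (x : Space)
    (Φ : PeriodicTrialState N L) :
    impurityPeriodicGroundStateEnergy v N L x ≤ impurityPeriodicEnergy v x Φ :=
  iInf_le _ Φ

/-- `E(N, L) ≤ E_imp(N, L, x)`: the scatterer raises the ground-state energy. [folklore] -/
theorem periodicGroundStateEnergy_le_impurityPeriodicGroundStateEnergy (v : ℝ → ℝ≥0∞) (N : ℕ)
    (L : ℝ) (x : Space) :
    periodicGroundStateEnergy v N L ≤ impurityPeriodicGroundStateEnergy v N L x :=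
  iInf_mono fun Φ => periodicEnergy_le_impurityPeriodicEnergy v x Φ

/-! ### The free case `v = 0` -/

/-- The periodisation of the zero potential vanishes. [folklore] -/
@[simp]
theorem periodizedPotential_zero (L : ℝ) (y : Space) : periodizedPotential 0 L y = 0 := by
  simp [periodizedPotential]

/-- Without interaction there is no scatterer either. [folklore] -/
@[simp]
theorem impurityInteraction_zero (L : ℝ) (x : Space) (X : Config N) :
    impurityInteraction 0 L x X = 0 := by
  simp [impurityInteraction]

/-- For `v = 0` the pinned-scatterer energy is the free periodic energy. [folklore] -/
@[simp]
theorem impurityPeriodicEnergy_zero_potential (x : Space) (Φ : PeriodicTrialState N L) :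
    impurityPeriodicEnergy 0 x Φ = periodicEnergy 0 Φ := by
  simp [impurityPeriodicEnergy]

/-- For `v = 0` the pinned-scatterer ground-state energy is the free one. [folklore] -/
@[simp]
theorem impurityPeriodicGroundStateEnergy_zero_potential (N : ℕ) (L : ℝ) (x : Space) :
    impurityPeriodicGroundStateEnergy 0 N L x = periodicGroundStateEnergy 0 N L := by
  simp [impurityPeriodicGroundStateEnergy, periodicGroundStateEnergy]

/-! ### Lattice covariance in the scatterer position -/

/-- Coordinates of a lattice vector (local copy of the `rfl` lemma of the proof files).
[folklore] -/
private theorem latticeVec_apply_aux (L : ℝ) (n : Fin 3 → ℤ) (k : Fin 3) :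
    latticeVec L n k = L * n k :=
  rfl

/-- `L(m - n) = Lm - Ln`. [folklore] -/
private theorem latticeVec_sub_aux (L : ℝ) (m n : Fin 3 → ℤ) :
    latticeVec L (m - n) = latticeVec L m - latticeVec L n := by
  ext k
  rw [WithLp.ofLp_sub, Pi.sub_apply, latticeVec_apply_aux, latticeVec_apply_aux,
    latticeVec_apply_aux, Pi.sub_apply, Int.cast_sub, mul_sub]

/-- `L e_k` is the lattice vector of `e_k ∈ ℤ³`. [folklore] -/
private theorem euclideanSingle_eq_latticeVec_aux (L : ℝ) (k : Fin 3) :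
    EuclideanSpace.single k L = latticeVec L (Pi.single k 1) := by
  ext j
  rw [latticeVec_apply_aux, PiLp.single_apply]
  by_cases h : j = k
  · subst h; simp
  · simp [h]

/-- The periodised potential is `Lℤ³`-periodic: `v^per(y + Ln) = v^per(y)` (re-indexing the
lattice sum). [cite: Fournais2020, (1.1)] -/
theorem periodizedPotential_add_latticeVec (v : ℝ → ℝ≥0∞) (L : ℝ) (y : Space) (n : Fin 3 → ℤ) :
    periodizedPotential v L (y + latticeVec L n) = periodizedPotential v L y := by
  unfold periodizedPotential
  calc ∑' m, v ‖y + latticeVec L n - latticeVec L m‖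
      = ∑' m, (fun m' => v ‖y - latticeVec L m'‖) (Equiv.subRight n m) :=
        tsum_congr fun m => by
          show v ‖y + latticeVec L n - latticeVec L m‖ = v ‖y - latticeVec L (m - n)‖
          rw [latticeVec_sub_aux, sub_sub_eq_add_sub]
    _ = ∑' m, v ‖y - latticeVec L m‖ :=
        (Equiv.subRight n).tsum_eq fun m' => v ‖y - latticeVec L m'‖

/-- `v^per(y - Ln) = v^per(y)`. [cite: Fournais2020, (1.1)] -/
theorem periodizedPotential_sub_latticeVec (v : ℝ → ℝ≥0∞) (L : ℝ) (y : Space) (n : Fin 3 → ℤ) :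
    periodizedPotential v L (y - latticeVec L n) = periodizedPotential v L y := by
  have h := periodizedPotential_add_latticeVec v L (y - latticeVec L n) n
  rw [sub_add_cancel] at h
  exact h.symm

/-- Moving the scatterer by a lattice vector does not change its potential:
`V_{x + Ln}(X) = V_x(X)` (the scatterer lives on the torus). [folklore] -/
theorem impurityInteraction_add_latticeVec (v : ℝ → ℝ≥0∞) (L : ℝ) (x : Space) (X : Config N)
    (n : Fin 3 → ℤ) :
    impurityInteraction v L (x + latticeVec L n) X = impurityInteraction v L x X := by
  unfold impurityInteraction
  refine Finset.sum_congr rfl fun j _ => ?_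
  rw [sub_add_eq_sub_sub, periodizedPotential_sub_latticeVec]

/-- `V_{x - Ln}(X) = V_x(X)`. [folklore] -/
theorem impurityInteraction_sub_latticeVec (v : ℝ → ℝ≥0∞) (L : ℝ) (x : Space) (X : Config N)
    (n : Fin 3 → ℤ) :
    impurityInteraction v L (x - latticeVec L n) X = impurityInteraction v L x X := by
  have h := impurityInteraction_add_latticeVec v L (x - latticeVec L n) X n
  rw [sub_add_cancel] at h
  exact h.symm

/-- **Lattice covariance.** At fixed state, lattice translates of the scatterer have the same
energy: `impurityPeriodicEnergy v (x + Ln) Φ = impurityPeriodicEnergy v x Φ`. [folklore] -/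
theorem impurityPeriodicEnergy_add_latticeVec (v : ℝ → ℝ≥0∞) (x : Space)
    (Φ : PeriodicTrialState N L) (n : Fin 3 → ℤ) :
    impurityPeriodicEnergy v (x + latticeVec L n) Φ = impurityPeriodicEnergy v x Φ := by
  simp only [impurityPeriodicEnergy_eq, impurityInteraction_add_latticeVec]

/-- `impurityPeriodicEnergy v (x - Ln) Φ = impurityPeriodicEnergy v x Φ`. [folklore] -/
theorem impurityPeriodicEnergy_sub_latticeVec (v : ℝ → ℝ≥0∞) (x : Space)
    (Φ : PeriodicTrialState N L) (n : Fin 3 → ℤ) :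
    impurityPeriodicEnergy v (x - latticeVec L n) Φ = impurityPeriodicEnergy v x Φ := by
  simp only [impurityPeriodicEnergy_eq, impurityInteraction_sub_latticeVec]

/-- The pinned-scatterer ground-state energy only depends on `x mod Lℤ³`. [folklore] -/
theorem impurityPeriodicGroundStateEnergy_add_latticeVec (v : ℝ → ℝ≥0∞) (N : ℕ) (L : ℝ)
    (x : Space) (n : Fin 3 → ℤ) :
    impurityPeriodicGroundStateEnergy v N L (x + latticeVec L n) =
      impurityPeriodicGroundStateEnergy v N L x := by
  simp only [impurityPeriodicGroundStateEnergy, impurityPeriodicEnergy_add_latticeVec]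

/-- `E_imp(N, L, x - Ln) = E_imp(N, L, x)`. [folklore] -/
theorem impurityPeriodicGroundStateEnergy_sub_latticeVec (v : ℝ → ℝ≥0∞) (N : ℕ) (L : ℝ)
    (x : Space) (n : Fin 3 → ℤ) :
    impurityPeriodicGroundStateEnergy v N L (x - latticeVec L n) =
      impurityPeriodicGroundStateEnergy v N L x := by
  simp only [impurityPeriodicGroundStateEnergy, impurityPeriodicEnergy_sub_latticeVec]

/-- The impurity potential is `Lℤ³`-periodic in every boson coordinate:
`V_x(X + eᵢ ⊗ L e_k) = V_x(X)` (so `V_x |Φ|²` is an admissible integrand on the torus). [folklore] -/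
theorem impurityInteraction_add_single (v : ℝ → ℝ≥0∞) (L : ℝ) (x : Space) (X : Config N)
    (i : Fin N) (k : Fin 3) :
    impurityInteraction v L x (X + Pi.single i (EuclideanSpace.single k L)) =
      impurityInteraction v L x X := by
  unfold impurityInteraction
  refine Finset.sum_congr rfl fun j _ => ?_
  rw [Pi.add_apply]
  by_cases h : j = i
  · subst h
    rw [Pi.single_eq_same, euclideanSingle_eq_latticeVec_aux, add_sub_right_comm,
      periodizedPotential_add_latticeVec]
  · rw [Pi.single_eq_of_ne h, add_zero]

/-- A common translation of all bosons leaves the pair interaction unchanged. [folklore] -/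
theorem periodicInteraction_add_const (v : ℝ → ℝ≥0∞) (L : ℝ) (X : Config N) (t : Space) :
    periodicInteraction v L (X + fun _ => t) = periodicInteraction v L X := by
  simp only [periodicInteraction, Pi.add_apply, add_sub_add_right_eq_sub]

/-- A common translation of the scatterer and of all bosons leaves the impurity potential
unchanged: `V_{x + t}(X + t𝟙) = V_x(X)`. [folklore] -/
theorem impurityInteraction_add_const (v : ℝ → ℝ≥0∞) (L : ℝ) (x : Space) (X : Config N)
    (t : Space) :
    impurityInteraction v L (x + t) (X + fun _ => t) = impurityInteraction v L x X := by
  simp only [impurityInteraction, Pi.add_apply, add_sub_add_right_eq_sub]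

/-! ### A priori bound and finiteness -/

/-- `∑ⱼ v^per(xⱼ - x) ≤ N · sup v^per`. [folklore] -/
theorem impurityInteraction_le (v : ℝ → ℝ≥0∞) (L : ℝ) (x : Space) (X : Config N) :
    impurityInteraction v L x X ≤ N * ⨆ y, periodizedPotential v L y := by
  unfold impurityInteraction
  calc ∑ j, periodizedPotential v L (X j - x)
      ≤ ∑ _j : Fin N, ⨆ y, periodizedPotential v L y :=
        Finset.sum_le_sum fun j _ => le_iSup (fun y => periodizedPotential v L y) (X j - x)
    _ = N * ⨆ y, periodizedPotential v L y := by
        rw [Finset.sum_const, Finset.card_univ, Fintype.card_fin, nsmul_eq_mul]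

/-- **A priori bound**: the scatterer costs at most `N · sup v^per` on any normalised state,
`impurityPeriodicEnergy v x Φ ≤ periodicEnergy v Φ + N · sup v^per`. [folklore] -/
theorem impurityPeriodicEnergy_le_add (v : ℝ → ℝ≥0∞) (x : Space) (Φ : PeriodicTrialState N L) :
    impurityPeriodicEnergy v x Φ ≤ periodicEnergy v Φ + N * ⨆ y, periodizedPotential v L y := by
  rw [impurityPeriodicEnergy_eq]
  gcongr
  calc ∫⁻ X in cellN N L, impurityInteraction v L x X * (‖Φ.ψ X‖₊ : ℝ≥0∞) ^ 2
      ≤ ∫⁻ X in cellN N L, (N * ⨆ y, periodizedPotential v L y) * (‖Φ.ψ X‖₊ : ℝ≥0∞) ^ 2 :=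
        lintegral_mono fun X => mul_le_mul' (impurityInteraction_le v L x X) le_rfl
    _ = (N * ⨆ y, periodizedPotential v L y) * ∫⁻ X in cellN N L, (‖Φ.ψ X‖₊ : ℝ≥0∞) ^ 2 :=
        lintegral_const_mul _
          ((Φ.contDiff.continuous.measurable.nnnorm.coe_nnreal_ennreal).pow_const _)
    _ = N * ⨆ y, periodizedPotential v L y := by rw [Φ.norm_eq, mul_one]

/-- `E_imp(N, L, x) ≤ E(N, L) + N · sup v^per`. [folklore] -/
theorem impurityPeriodicGroundStateEnergy_le_add (v : ℝ → ℝ≥0∞) (N : ℕ) (L : ℝ) (x : Space) :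
    impurityPeriodicGroundStateEnergy v N L x ≤
      periodicGroundStateEnergy v N L + N * ⨆ y, periodizedPotential v L y := by
  rw [periodicGroundStateEnergy, ENNReal.iInf_add]
  exact iInf_mono fun Φ => impurityPeriodicEnergy_le_add v x Φ

/-- **Finiteness criterion**: if the impurity-free ground-state energy is finite and the
periodised potential is bounded (e.g. a bounded `v` of range `R₀ < L/2`), the pinned-scatterer
ground-state energy is finite at every scatterer position. [folklore] -/
theorem impurityPeriodicGroundStateEnergy_ne_top {v : ℝ → ℝ≥0∞} {N : ℕ} {L : ℝ}
    (hE : periodicGroundStateEnergy v N L ≠ ⊤) (hv : (⨆ y, periodizedPotential v L y) ≠ ⊤)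
    (x : Space) : impurityPeriodicGroundStateEnergy v N L x ≠ ⊤ :=
  ne_top_of_le_ne_top
    (ENNReal.add_ne_top.2 ⟨hE, ENNReal.mul_ne_top (ENNReal.natCast_ne_top N) hv⟩)
    (impurityPeriodicGroundStateEnergy_le_add v N L x)

end Literature.MathematicalPhysics.QuantumManyBody.BoseGas

end
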